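import Literature.Analysis.OperatorTheory.Enflo2023.MCStep
import Literature.Analysis.OperatorTheory.Enflo2023.PipelineL2
import HarnessLib

/-!
# Enflo 2023, v2 pp.17–20: audit of the residual claim `MCStep.Claim` — bounded from both sides

Source under adjudication: Per H. Enflo, *On the invariant subspace problem in Hilbert spaces*, arXiv:2305.15442 (v1
2023, v2 2024), bib key `Enflo2023` — a CLAIMED proof of the invariant subspace problem for operators on a separable
Hilbert space (claimed result under adjudication).  This file is part of the kernel-tight typing of the manuscript by
the b2b-enflo repair cell (formaliser 2, Part B; BLOCK-2b).  NOTHING here asserts that the manuscript's main theorem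
holds; no declaration concludes the invariant subspace problem for an arbitrary operator.  Value: theorems ABOUT the
cell's residual hypothesis `MCStep.Claim T x₀ S C β G` (file `MCStep`), answering the referee's standing question
"is the residual trivially unsatisfiable, or the problem restated?" with kernel facts, numbers not adjectives.

## (A) The identity behind everything: `Re⟨v, x₀⟩ = ‖v‖² + (εθ)` at every state (v2 (16), p.6)

`State.re_inner_v_x₀`.  With the window `‖v‖ = ε ∈ [0.3, 0.7]` it ties the drift of (45) to the change of radius.

## (B) A hard-window artefact: the drift constant of (45) must be `≥ 1` (`not_claim_of_C_lt_one`)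

For EVERY operator `T` with `‖T‖ < 1` (the normalisation of `Pipeline.wlog_opNorm`), every unit vector `x₀`, every
`β > 0`, every angle modulus `G` and every `C < 1`, `MCStep.Claim T x₀ Vy.S C β G` is FALSE.  Witness: the pivot
`P` = the minimal move of `y = x₀` itself at radius `0.7` (it exists: `Vy.exists_isMinimal_of_norm_sub_le`; its
`(εθ)_P > 0` by (5) with `r = e₀`, since `V_{x₀} e₀ = x₀`).  `P` lies in its own epoch invariant, so the Claim must
produce a state `s'` with `(εθ)_{s'} ≤ (1 − β)(εθ)_P` and `Re⟨x₀, v_{s'} − v_P⟩ ≥ −Cβ(εθ)_P`; by (A) and the window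
`‖v_{s'}‖ ≤ 0.7 = ‖v_P‖` this gives `(1 − C)β(εθ)_P ≤ 0`, impossible.  READING: the manuscript's own constant in
(45) is `10` (honestly `202`, `Eq45.printed_eq45_constant_fails`), so (B) does not touch the text; it says that the
cell's typing with the HARD window `ε ∈ [0.3, 0.7]` (v2 p.5 l.152: "`0.7 > ε > 0.3` … for the whole sequence") makes
part of the drift budget of (45) COMPULSORY at the top of the window — a state at radius `0.7` can only lose `(εθ)`
by moving towards smaller `Re⟨v, x₀⟩` — a constraint the first-order mechanism (41)–(44) of the text never mentions.
Any sufficiency theorem with hypothesis `Claim … C …`, `C < 1`, is vacuous.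

## (C) Consistency: the Claim HOLDS for the zero operator (`claim_zero`, `claim_threshold`)

On an infinite-dimensional Hilbert space, `T = 0` (which of course has invariant subspaces — consistency of a
hypothesis schema is all that is claimed) satisfies `MCStep.Claim 0 x₀ Vy.S 1 β (fun E ↦ 200|E|)` for every unit
`x₀` and every `β ∈ [0, 1]`.  States of `T = 0` with MC vector `v` exist for every `v` with `‖v‖ ∈ [0.3, 0.7]`,
`⟨v, x₀⟩ ∈ ℝ` and `‖v‖² ≤ Re⟨v, x₀⟩` (`ZeroModel.exists_state`: `V = (· 0) • (x₀ − v)`, `a = e₀`, minimal because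
feasibility of `λ(x₀ − v)` forces `|λ| ≥ 1`, `ZeroModel.one_le_norm_coeff`); the step is RADIUS-PRESERVING with drift
exactly `−β(εθ)_s` (so `C = 1` is attained, matching (B)): for pivots with `(εθ)_P ≥ 1/100` the side-condition
vector is a unit vector orthogonal to `x₀` and `v_P` (admissible since `G((εθ)_P) = 200(εθ)_P ≥ 2` bounds the angle
expression by the triangle inequality) and the step is `−β(εθ)_s x₀ + τ d` with `d ⊥ x₀, v_s, c`
(`ZeroModel.exists_step_orth`); for pivots with `(εθ)_P < 1/100` the vector is the moved vector `x₀ − v_P` itself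
(angle `0`, `MCStep.pivot_clause_trivial`) and the step is `−β(εθ)_s x₀ + k w_P + τ d` with the compensator
`w_P = v_P − ⟨x₀, v_P⟩x₀`, `‖w_P‖² = ‖v_P‖² − Re⟨v_P, x₀⟩² ≥ 0.07` there (`ZeroModel.arith_W`), which fits inside the
sphere `‖·‖ = ‖v_s‖` because the epoch invariant `InvP 1 P (x₀ − v_P) s` pins `⟨v_P, v_s⟩ = ‖v_P‖² + μ_s − μ_P ∈ ℝ`
and `|μ_s − μ_P| ≤ (εθ)_P − (εθ)_s < 1/100` (`μ = Re⟨v, x₀⟩`; `ZeroModel.exists_step_pivot`, `ZeroModel.arith_gap`).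
Hence `MCStep.hasNontrivialClosedInvariantSubspace_of_claim` has non-vacuous instances (its hypotheses on `G` hold for
`E ↦ 200|E|`), and the residual is a genuine (satisfiable, operator-dependent) statement — NOT refutable by typing
alone; `claim_threshold` records that under the hard window `C = 1` is exactly the threshold.  Whether the Claim holds
for some operator WITHOUT a non-trivial closed invariant subspace is precisely what the manuscript's pp.17–20 would
have to deliver and is open.

No new axioms; every theorem has closure `[propext, Classical.choice, Quot.sound]`.
-/

noncomputable section

open scoped InnerProductSpace ComplexConjugate
open Filter Topology RCLike

namespace Literature.Analysis.OperatorTheory.Enflo2023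

namespace MCStep

variable {E H : Type*} [NormedAddCommGroup E] [InnerProductSpace ℂ E] [CompleteSpace E]
  [NormedAddCommGroup H] [InnerProductSpace ℂ H] [CompleteSpace H]

namespace State

variable {T : H →L[ℂ] H} {x₀ : H} {S : E →L[ℂ] E}

/-! ### (A) `Re⟨v, x₀⟩ = ‖v‖² + (εθ)` -/

/-- (16) rearranged: at a state, `Re⟨v, x₀⟩ = ‖v‖² + (εθ)`. [cite: Enflo2023, v2 (16), p.6] -/
lemma re_inner_v_x₀ (s : State T x₀ S) (hx₀ : ‖x₀‖ = 1) :
    (⟪s.v, x₀⟫_ℂ).re = ‖s.v‖ ^ 2 + s.etheta := by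
  have h := congrArg Complex.re (s.hid hx₀)
  rw [inner_sub_right, Complex.sub_re, Complex.ofReal_re] at h
  have h2 : (⟪s.v, s.v⟫_ℂ).re = ‖s.v‖ ^ 2 := by
    have := inner_self_eq_norm_sq (𝕜 := ℂ) s.v
    rwa [RCLike.re_to_complex] at this
  linarith

/-- (16) rearranged, `x₀` on the left: `Re⟨x₀, v⟩ = ‖v‖² + (εθ)`. [cite: Enflo2023, v2 (16), p.6] -/
lemma re_inner_x₀_v (s : State T x₀ S) (hx₀ : ‖x₀‖ = 1) :
    (⟪x₀, s.v⟫_ℂ).re = ‖s.v‖ ^ 2 + s.etheta := by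
  rw [← RCLike.re_to_complex, inner_re_symm, RCLike.re_to_complex]; exact s.re_inner_v_x₀ hx₀

/-- `⟨v, x₀⟩` is real at a state. [cite: Enflo2023, v2 (16), p.6] -/
lemma im_inner_v_x₀ (s : State T x₀ S) (hx₀ : ‖x₀‖ = 1) : (⟪s.v, x₀⟫_ℂ).im = 0 := by
  have h := congrArg Complex.im (s.hid hx₀)
  rw [inner_sub_right, Complex.sub_im, Complex.ofReal_im] at h
  have h2 : (⟪s.v, s.v⟫_ℂ).im = 0 := by
    have := inner_self_im (𝕜 := ℂ) s.v
    rwa [RCLike.im_to_complex] at this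
  linarith

/-- `⟨v, x₀⟩ = ‖v‖² + (εθ)` as a complex number. [cite: Enflo2023, v2 (16), p.6] -/
lemma inner_v_x₀ (s : State T x₀ S) (hx₀ : ‖x₀‖ = 1) :
    ⟪s.v, x₀⟫_ℂ = ((‖s.v‖ ^ 2 + s.etheta : ℝ) : ℂ) :=
  Complex.ext (by rw [Complex.ofReal_re]; exact s.re_inner_v_x₀ hx₀)
    (by rw [Complex.ofReal_im]; exact s.im_inner_v_x₀ hx₀)

/-- `(εθ) ≤ 1/4` at every state (`Re⟨v, x₀⟩ ≤ ‖v‖`, so `(εθ) ≤ ‖v‖ − ‖v‖²`). [cite: Enflo2023, v2 (16), p.6] -/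
lemma etheta_le_quarter (s : State T x₀ S) (hx₀ : ‖x₀‖ = 1) : s.etheta ≤ 1 / 4 := by
  have h1 := s.re_inner_v_x₀ hx₀
  have h2 : (⟪s.v, x₀⟫_ℂ).re ≤ ‖s.v‖ := by
    calc (⟪s.v, x₀⟫_ℂ).re ≤ ‖⟪s.v, x₀⟫_ℂ‖ := Complex.re_le_norm _
      _ ≤ ‖s.v‖ * ‖x₀‖ := norm_inner_le_norm _ _
      _ = ‖s.v‖ := by rw [hx₀, mul_one]
  nlinarith [sq_nonneg (‖s.v‖ - 1 / 2)]

end State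

/-! ### (B) The drift constant must be at least `1` under the hard window -/

/-- The pivot of the witness: the minimal move of `y = x₀` itself at radius `0.7` is a state (for the `ℓ²`
coefficient model `V_{x₀}`, `S` = right shift). [cite: Enflo2023, v2 (1)–(2), p.2] -/
theorem exists_state_self (T : H →L[ℂ] H) (hT : ‖T‖ < 1) (x₀ : H) :
    ∃ P : State T x₀ Vy.S, P.V = Vy.V T hT x₀ ∧ P.ε = 0.7 := by
  have hfeas : ‖x₀ - x₀‖ ≤ (0.7 : ℝ) := by rw [sub_self, norm_zero]; norm_num
  obtain ⟨a, ha⟩ := Vy.exists_isMinimal_of_norm_sub_le T hT hfeas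
  exact ⟨⟨Vy.V T hT x₀, Vy.V_shift T hT x₀, 0.7, ⟨by norm_num, le_rfl⟩, a, ha⟩, rfl, rfl⟩

/-- At the self-pivot `(εθ) > 0`: otherwise (5)/(6) give `C' = 0`, so `x₀ − Vℓ' ⊥ V e₀ = x₀`, contradicting
`Re⟨v, x₀⟩ = 0.49 + (εθ)`. [cite: Enflo2023, v2 (5)–(6), p.3] -/
theorem etheta_pos_of_self (T : H →L[ℂ] H) (hT : ‖T‖ < 1) (x₀ : H) (hx₀ : ‖x₀‖ = 1)
    (P : State T x₀ Vy.S) (hV : P.V = Vy.V T hT x₀) : 0 < P.etheta := by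
  have hne : P.a ≠ 0 := P.hmin.ne_zero (P.eps_lt hx₀)
  obtain ⟨C', hC'0, hC'⟩ := P.hmin.kkt hne
  have h6 := IsMinimal.eq6 hC'
  have hE : P.etheta = C' * ‖P.a‖ ^ 2 := by
    show (⟪x₀ - P.V P.a, P.V P.a⟫_ℂ).re = _
    rw [h6, Complex.ofReal_re]
  rcases hC'0.lt_or_eq with hpos | hzero
  · rw [hE]; exact mul_pos hpos (by positivity)
  · exfalso
    have h5 := IsMinimal.eq5 hC' (lp.single 2 0 (1 : ℂ))
    rw [← hzero] at h5
    have hx : P.V (lp.single 2 0 (1 : ℂ)) = x₀ := by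
      rw [hV, Vy.V_single, pow_zero, one_apply_eq_self]
    rw [hx] at h5
    have hre := P.re_inner_v_x₀ hx₀
    have hv : P.v = x₀ - P.V P.a := rfl
    rw [hv, h5] at hre
    simp only [Complex.ofReal_zero, zero_mul, Complex.zero_re] at hre
    have hn : ‖x₀ - P.V P.a‖ = P.ε := P.norm_v hx₀
    rw [hn] at hre
    have := P.etheta_nonneg hx₀ Vy.norm_S_le
    nlinarith [P.hε.1]

omit [CompleteSpace E] [CompleteSpace H] in
/-- Every state lies in its own epoch invariant (for any side-condition vector). [cite: Enflo2023, v2 p.19] -/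
lemma invP_self' {T : H →L[ℂ] H} {x₀ : H} {S : E →L[ℂ] E} (C : ℝ) (P : State T x₀ S) (c : H) :
    InvP C P c P := by
  refine ⟨le_rfl, ?_, ?_⟩
  · rw [sub_self, inner_zero_right]
  · rw [sub_self, inner_zero_right, map_zero, abs_zero, sub_self, mul_zero]

/-- **(B) The hard-window artefact.**  For every `T` with `‖T‖ < 1`, unit `x₀`, `β > 0`, `G`, and `C < 1`, the
residual claim `MCStep.Claim T x₀ Vy.S C β G` is false: from the self-pivot at radius `0.7` a step must keep
`‖v‖ ≤ 0.7`, so by `Re⟨v, x₀⟩ = ‖v‖² + (εθ)` the drift is `≤ −β(εθ)_P < −Cβ(εθ)_P`.  (The manuscript's (45) has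
`C = 10`; this bounds the cell's typing, not the text.) [cite: Enflo2023, v2 (16) p.6, (45) p.19, p.5 l.152] -/
theorem not_claim_of_C_lt_one (T : H →L[ℂ] H) (hT : ‖T‖ < 1) (x₀ : H) (hx₀ : ‖x₀‖ = 1)
    {C β : ℝ} (hC : C < 1) (hβ : 0 < β) (G : ℝ → ℝ) :
    ¬ Claim T x₀ Vy.S C β G := by
  intro hclaim
  obtain ⟨P, hPV, hPε⟩ := exists_state_self T hT x₀
  have hpos : 0 < P.etheta := etheta_pos_of_self T hT x₀ hx₀ P hPV
  obtain ⟨c, -, -, hstep⟩ := hclaim P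
  obtain ⟨s', h1, -, h3⟩ := hstep P (invP_self' C P c)
  have eP := P.re_inner_x₀_v hx₀
  have es := s'.re_inner_x₀_v hx₀
  have nP : ‖P.v‖ = 0.7 := by rw [P.norm_v hx₀, hPε]
  have ns : ‖s'.v‖ ≤ 0.7 := by rw [s'.norm_v hx₀]; exact s'.hε.2
  have ns2 : ‖s'.v‖ ^ 2 ≤ 0.7 ^ 2 := pow_le_pow_left₀ (norm_nonneg _) ns 2
  have hd : -(C * β * P.etheta) ≤ re ⟪x₀, s'.v - P.v⟫_ℂ := (abs_le.mp h3).1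
  rw [inner_sub_right, map_sub, RCLike.re_to_complex, RCLike.re_to_complex, es, eP, nP] at hd
  nlinarith [mul_pos (mul_pos hβ hpos) (sub_pos.mpr hC)]


/-! ### (C) Consistency: the zero operator satisfies the Claim -/

namespace ZeroModel

/-! #### States of `T = 0`: every `v` with `‖v‖ = ε`, `⟨v, x₀⟩ ∈ ℝ`, `‖v‖² ≤ Re⟨v, x₀⟩` -/

/-- The rank-one coefficient operator `b ↦ b₀ • u` (the `V_y` of `T = 0` with `y = u`). [cite: Enflo2023, v2 (2), p.2] -/
def rk1 (u : H) : Vy.ℓ2 →L[ℂ] H :=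
  LinearMap.mkContinuous
    { toFun := fun b => (b 0) • u
      map_add' := fun b b' => by simp [add_smul]
      map_smul' := fun c b => by simp [smul_smul] }
    ‖u‖ (fun b => by
      show ‖(b 0) • u‖ ≤ ‖u‖ * ‖b‖
      rw [norm_smul, mul_comm]
      exact mul_le_mul_of_nonneg_left (lp.norm_apply_le_norm (by norm_num) b 0) (norm_nonneg _))

omit [CompleteSpace H] in
/-- Unfolding `rk1`. [cite: Enflo2023, v2 (2), p.2] -/
@[simp] lemma rk1_apply (u : H) (b : Vy.ℓ2) : rk1 u b = (b 0) • u := rfl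

omit [CompleteSpace H] in
/-- `rk1 u` intertwines the right shift with `T = 0`. [cite: Enflo2023, v2 (9), p.4] -/
lemma rk1_shift (u : H) (b : Vy.ℓ2) : rk1 u (Vy.S b) = (0 : H →L[ℂ] H) (rk1 u b) := by
  simp [rk1_apply]

omit [CompleteSpace H] in
/-- The minimality computation for `T = 0`: if `⟨x₀, u⟩ = 1 − μ` with `μ < 1` and `‖x₀ − u‖² ≤ μ`
(i.e. `Re⟨x₀ − u, u⟩ ≥ 0`), then every `λ` with `‖x₀ − λu‖ ≤ ‖x₀ − u‖` has `|λ| ≥ 1`. [cite: Enflo2023, v2 (1), p.2] -/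
lemma one_le_norm_coeff {x₀ u : H} (hx₀ : ‖x₀‖ = 1) {μ : ℝ} (hxu : ⟪x₀, u⟫_ℂ = ((1 - μ : ℝ) : ℂ))
    (hμ1 : μ < 1) (hρμ : ‖x₀ - u‖ ^ 2 ≤ μ) {l : ℂ} (hl : ‖x₀ - l • u‖ ≤ ‖x₀ - u‖) : 1 ≤ ‖l‖ := by
  have hu2 : ‖x₀ - u‖ ^ 2 = 1 - 2 * (1 - μ) + ‖u‖ ^ 2 := by
    rw [norm_sub_sq (𝕜 := ℂ), hx₀, hxu, RCLike.re_to_complex, Complex.ofReal_re, one_pow]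
  have hexp : ‖x₀ - l • u‖ ^ 2 = 1 - 2 * ((1 - μ) * l.re) + ‖l‖ ^ 2 * ‖u‖ ^ 2 := by
    rw [norm_sub_sq (𝕜 := ℂ), hx₀, inner_smul_right, hxu, RCLike.re_to_complex, mul_comm l,
      Complex.re_ofReal_mul, norm_smul, mul_pow, one_pow]
  have hsq : ‖x₀ - l • u‖ ^ 2 ≤ ‖x₀ - u‖ ^ 2 := pow_le_pow_left₀ (norm_nonneg _) hl 2
  by_contra h
  rw [not_le] at h
  have hre : l.re ≤ ‖l‖ := Complex.re_le_norm l
  have h0 : 0 ≤ ‖l‖ := norm_nonneg l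
  have hre' := mul_le_mul_of_nonneg_left hre (by linarith : (0:ℝ) ≤ 2 * (1 - μ))
  rw [hexp, hu2] at hsq
  nlinarith [mul_pos (mul_pos (sub_pos.2 h) (sub_pos.2 h)) (sub_pos.2 hμ1),
    mul_nonneg (mul_nonneg (sub_nonneg.2 h.le) (by linarith : (0:ℝ) ≤ 1 + ‖l‖)) (sub_nonneg.2 hρμ),
    mul_nonneg (mul_nonneg h0 h0) (sq_nonneg ‖u‖)]

omit [CompleteSpace H] in
/-- **States of the zero operator.**  Every `v` with `‖v‖ ∈ [0.3, 0.7]`, `⟨v, x₀⟩ ∈ ℝ` and `‖v‖² ≤ Re⟨v, x₀⟩` is the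
MC vector of a state of `T = 0` (`V = rk1 (x₀ − v)`, `a = e₀`, `ε = ‖v‖`). [cite: Enflo2023, v2 (1)–(2), p.2] -/
theorem exists_state (x₀ : H) (hx₀ : ‖x₀‖ = 1) (v : H) (hw : (0.3 : ℝ) ≤ ‖v‖ ∧ ‖v‖ ≤ 0.7)
    (hreal : (⟪v, x₀⟫_ℂ).im = 0) (hpos : ‖v‖ ^ 2 ≤ (⟪v, x₀⟫_ℂ).re) :
    ∃ s : State (0 : H →L[ℂ] H) x₀ Vy.S, s.v = v := by
  set μ := (⟪v, x₀⟫_ℂ).re with hμ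
  have hvx : ⟪v, x₀⟫_ℂ = (μ : ℂ) := Complex.ext (by rw [Complex.ofReal_re]) (by rw [Complex.ofReal_im, hreal])
  have hxv : ⟪x₀, v⟫_ℂ = (μ : ℂ) := by rw [← inner_conj_symm, hvx, Complex.conj_ofReal]
  have hμ1 : μ < 1 := by
    have h1 : μ ≤ ‖v‖ := by
      calc μ ≤ ‖⟪v, x₀⟫_ℂ‖ := Complex.re_le_norm _
        _ ≤ ‖v‖ * ‖x₀‖ := norm_inner_le_norm _ _
        _ = ‖v‖ := by rw [hx₀, mul_one]
    linarith [hw.2]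
  set u := x₀ - v with hu
  have hxu : ⟪x₀, u⟫_ℂ = ((1 - μ : ℝ) : ℂ) := by
    rw [hu, inner_sub_right, inner_self_eq_norm_sq_to_K, hx₀, hxv]; push_cast; ring
  have hx0u : x₀ - u = v := sub_sub_cancel _ _
  refine ⟨⟨rk1 u, rk1_shift u, ‖v‖, hw, lp.single 2 0 (1:ℂ), ?_, ?_⟩, ?_⟩
  · rw [mem_feasible, rk1_apply, lp.single_apply, Pi.single_eq_same, one_smul, hx0u]
  · intro b hb
    rw [mem_feasible, rk1_apply] at hb
    rw [lp.norm_single (by norm_num), norm_one]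
    have h1 : 1 ≤ ‖b 0‖ :=
      one_le_norm_coeff hx₀ hxu hμ1 (by rw [hx0u]; exact hpos) (by rw [hx0u]; exact hb)
    exact h1.trans (lp.norm_apply_le_norm (by norm_num) b 0)
  · show x₀ - rk1 u (lp.single 2 0 1) = v
    rw [rk1_apply, lp.single_apply, Pi.single_eq_same, one_smul, hx0u]

/-- A state one step on: if `‖v_s + z‖ = ‖v_s‖` and `⟨z, x₀⟩ = −η` with `0 ≤ η ≤ (εθ)_s`, then `v_s + z` is the MC
vector of a state with `(εθ) = (εθ)_s − η` (radius preserved). [cite: Enflo2023, v2 (16), p.6; p.19] -/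
theorem exists_state_add {x₀ : H} (hx₀ : ‖x₀‖ = 1) (s : State (0 : H →L[ℂ] H) x₀ Vy.S) (z : H) {η : ℝ}
    (hηE : η ≤ s.etheta) (hnorm : ‖s.v + z‖ = ‖s.v‖) (hz : ⟪z, x₀⟫_ℂ = -((η : ℝ) : ℂ)) :
    ∃ s' : State (0 : H →L[ℂ] H) x₀ Vy.S, s'.v = s.v + z ∧ s'.etheta = s.etheta - η := by
  have hin : ⟪s.v + z, x₀⟫_ℂ = ((‖s.v‖ ^ 2 + s.etheta - η : ℝ) : ℂ) := by
    rw [inner_add_left, s.inner_v_x₀ hx₀, hz]; push_cast; ring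
  have hw : (0.3 : ℝ) ≤ ‖s.v + z‖ ∧ ‖s.v + z‖ ≤ 0.7 := by rw [hnorm]; exact s.window hx₀
  obtain ⟨s', hs'⟩ := exists_state x₀ hx₀ (s.v + z) hw (by rw [hin, Complex.ofReal_im])
    (by rw [hin, Complex.ofReal_re, hnorm]; linarith)
  refine ⟨s', hs', ?_⟩
  have h := s'.re_inner_v_x₀ hx₀
  rw [hs', hin, Complex.ofReal_re, hnorm] at h
  linarith

/-! #### Room: a unit vector orthogonal to three given ones (infinite dimension) -/

omit [CompleteSpace H] in
/-- In an infinite-dimensional Hilbert space there is a unit vector orthogonal to any three vectors. [folklore] -/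
lemma exists_unit_orth3 (hH : ¬ FiniteDimensional ℂ H) (x y z : H) :
    ∃ d : H, ‖d‖ = 1 ∧ ⟪x, d⟫_ℂ = 0 ∧ ⟪y, d⟫_ℂ = 0 ∧ ⟪z, d⟫_ℂ = 0 := by
  let K : Submodule ℂ H := Submodule.span ℂ ({x, y, z} : Set H)
  haveI : FiniteDimensional ℂ K := FiniteDimensional.span_of_finite ℂ (Set.toFinite _)
  have hK : Kᗮ ≠ ⊥ := by
    intro h
    rw [Submodule.orthogonal_eq_bot_iff] at h
    apply hH
    haveI : FiniteDimensional ℂ (⊤ : Submodule ℂ H) := h ▸ (inferInstance : FiniteDimensional ℂ K)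
    exact LinearEquiv.finiteDimensional (Submodule.topEquiv : (⊤ : Submodule ℂ H) ≃ₗ[ℂ] H)
  obtain ⟨d, hd, hd0⟩ := Submodule.exists_mem_ne_zero_of_ne_bot hK
  have hx : x ∈ K := Submodule.subset_span (by simp)
  have hy : y ∈ K := Submodule.subset_span (by simp)
  have hz : z ∈ K := Submodule.subset_span (by simp)
  have hnd : ‖d‖ ≠ 0 := norm_ne_zero_iff.2 hd0
  refine ⟨((‖d‖⁻¹ : ℝ) : ℂ) • d, ?_, ?_, ?_, ?_⟩
  · rw [norm_smul, Complex.norm_real, Real.norm_of_nonneg (inv_nonneg.2 (norm_nonneg _)),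
      inv_mul_cancel₀ hnd]
  · rw [inner_smul_right, Submodule.inner_right_of_mem_orthogonal hx hd, mul_zero]
  · rw [inner_smul_right, Submodule.inner_right_of_mem_orthogonal hy hd, mul_zero]
  · rw [inner_smul_right, Submodule.inner_right_of_mem_orthogonal hz hd, mul_zero]

omit [CompleteSpace H] in
/-- Pythagoras for the step: `‖a + τd‖² = ‖a‖² + τ²` when `d ⊥ a`, `‖d‖ = 1`. [folklore] -/
lemma norm_sq_add_smul_orth {a d : H} (hd : ‖d‖ = 1) (had : ⟪a, d⟫_ℂ = 0) (τ : ℝ) :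
    ‖a + (τ : ℂ) • d‖ ^ 2 = ‖a‖ ^ 2 + τ ^ 2 := by
  rw [norm_add_sq (𝕜 := ℂ), inner_smul_right, had, mul_zero, map_zero, mul_zero, add_zero, norm_smul,
    Complex.norm_real, Real.norm_eq_abs, hd, mul_one, sq_abs]

/-! #### The arithmetic of the small-`(εθ)` regime (plain real inequalities) -/

/-- `‖w_P‖² = ρ_P − (ρ_P + (εθ)_P)² ≥ 0.07` on the window when `(εθ)_P < 1/100`. [folklore] -/
lemma arith_W {ρP EP : ℝ} (h1 : 0.09 ≤ ρP) (h2 : ρP ≤ 0.49) (h3 : 0 ≤ EP) (h4 : EP < 1 / 100) :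
    (7 : ℝ) / 100 ≤ ρP - (ρP + EP) ^ 2 := by
  nlinarith [mul_nonneg (sub_nonneg.2 h1) (sub_nonneg.2 h2), mul_nonneg (sub_nonneg.2 h2) h3,
    mul_nonneg h3 (sub_nonneg.2 h4.le)]

/-- `Re⟨v_s, w_P⟩ = ‖w_P‖² + (1 − μ_P)(μ_s − μ_P) ≥ 0` in the epoch. [folklore] -/
lemma arith_Bw {W μP δ : ℝ} (hW : 7 / 100 ≤ W) (hμP0 : 0.09 ≤ μP) (hμP1 : μP ≤ 0.5) (hδ : |δ| ≤ 1 / 100) :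
    0 ≤ W + (1 - μP) * δ := by
  have h := mul_le_mul_of_nonneg_left (abs_le.1 hδ).1 (by linarith : (0:ℝ) ≤ 1 - μP)
  nlinarith

/-- The compensated step fits inside the sphere: `gap · ‖w_P‖² ≥ 0`. [folklore] -/
lemma arith_gap {μs μP W Bw η : ℝ} (hμs : 0.09 ≤ μs) (hμP0 : 0.09 ≤ μP) (hμP1 : μP ≤ 0.5)
    (hW : 7 / 100 ≤ W) (hBw : 0 ≤ Bw) (hη0 : 0 ≤ η) (hη1 : η ≤ 1 / 100) :
    0 ≤ (2 * η * μs - η ^ 2) * W - 2 * (-(η * (1 - μP))) * Bw - (-(η * (1 - μP))) ^ 2 := by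
  have t1 : 0 ≤ (2 * μs - η - 0.17) * (W - 7 / 100) := mul_nonneg (by linarith) (by linarith)
  have t2 : 0 ≤ (1 - μP) * Bw := mul_nonneg (by linarith) hBw
  have t3 : (1 - μP) ^ 2 ≤ 0.8281 := by nlinarith
  have t4 : η * (1 - μP) ^ 2 ≤ 1 / 100 * 0.8281 :=
    (mul_le_mul_of_nonneg_left t3 hη0).trans (mul_le_mul_of_nonneg_right hη1 (by norm_num))
  have hb : 0 ≤ (2 * μs - η) * W + 2 * (1 - μP) * Bw - η * (1 - μP) ^ 2 := by nlinarith
  have h : (2 * η * μs - η ^ 2) * W - 2 * (-(η * (1 - μP))) * Bw - (-(η * (1 - μP))) ^ 2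
      = η * ((2 * μs - η) * W + 2 * (1 - μP) * Bw - η * (1 - μP) ^ 2) := by ring
  rw [h]; exact mul_nonneg hη0 hb

/-! #### The two steps -/

omit [CompleteSpace H] in
/-- `‖r • x‖² = r²‖x‖²` for a real scalar written in `ℂ`. [folklore] -/
lemma norm_sq_real_smul (r : ℝ) (x : H) : ‖(r : ℂ) • x‖ ^ 2 = r ^ 2 * ‖x‖ ^ 2 := by
  rw [norm_smul, Complex.norm_real, Real.norm_eq_abs, mul_pow, sq_abs]

/-- STEP, side-condition vector orthogonal to `x₀`: from any state `s`, the radius-preserving step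
`z = −β(εθ)_s x₀ + τ d` (`d ⊥ x₀, v_s, c`, `τ² = β(εθ)_s(2Re⟨v_s, x₀⟩ − β(εθ)_s)`) reaches a state with
`(εθ) = (1 − β)(εθ)_s`, `⟨c, z⟩ = 0` and drift exactly `−β(εθ)_s`. [cite: Enflo2023, v2 p.19, (45)–(46)] -/
theorem exists_step_orth (hH : ¬ FiniteDimensional ℂ H) {x₀ : H} (hx₀ : ‖x₀‖ = 1) {β : ℝ} (hβ0 : 0 ≤ β)
    (hβ1 : β ≤ 1) (c : H) (hc : ⟪c, x₀⟫_ℂ = 0) (s : State (0 : H →L[ℂ] H) x₀ Vy.S) :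
    ∃ s' : State (0 : H →L[ℂ] H) x₀ Vy.S, s'.etheta = (1 - β) * s.etheta ∧ ⟪c, s'.v - s.v⟫_ℂ = 0 ∧
      re ⟪x₀, s'.v - s.v⟫_ℂ = -(β * s.etheta) := by
  have hE0 : 0 ≤ s.etheta := s.etheta_nonneg hx₀ Vy.norm_S_le
  obtain ⟨η, hη⟩ : ∃ η : ℝ, η = β * s.etheta := ⟨_, rfl⟩
  have hη0 : 0 ≤ η := by rw [hη]; exact mul_nonneg hβ0 hE0
  have hηE : η ≤ s.etheta := by rw [hη]; nlinarith
  obtain ⟨μ, hμ⟩ : ∃ μ : ℝ, μ = ‖s.v‖ ^ 2 + s.etheta := ⟨_, rfl⟩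
  have hvx : ⟪s.v, x₀⟫_ℂ = (μ : ℂ) := by rw [hμ]; exact s.inner_v_x₀ hx₀
  have hxx : ⟪x₀, x₀⟫_ℂ = 1 := by rw [inner_self_eq_norm_sq_to_K, hx₀]; simp
  obtain ⟨d, hd1, hxd, hvd, hcd⟩ := exists_unit_orth3 hH x₀ s.v c
  have hdx : ⟪d, x₀⟫_ℂ = 0 := inner_eq_zero_symm.1 hxd
  obtain ⟨κ, hκ⟩ : ∃ κ : ℝ, κ = η * (2 * μ - η) := ⟨_, rfl⟩
  have hκ0 : 0 ≤ κ := by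
    rw [hκ]; apply mul_nonneg hη0; nlinarith [sq_nonneg ‖s.v‖]
  set τ := Real.sqrt κ with hτ
  set a : H := s.v - (η : ℂ) • x₀ with ha_def
  set z : H := -((η : ℂ) • x₀) + (τ : ℂ) • d with hz
  have hsz : s.v + z = a + (τ : ℂ) • d := by rw [hz, ha_def, sub_eq_add_neg, add_assoc]
  have ha : ‖a‖ ^ 2 = ‖s.v‖ ^ 2 - 2 * (η * μ) + η ^ 2 := by
    rw [ha_def, norm_sub_sq (𝕜 := ℂ), inner_smul_right, hvx, RCLike.re_to_complex, ← Complex.ofReal_mul,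
      Complex.ofReal_re, norm_sq_real_smul, hx₀]; ring
  have had : ⟪a, d⟫_ℂ = 0 := by
    rw [ha_def, inner_sub_left, inner_smul_left, hvd, hxd, mul_zero, sub_zero]
  have hnorm : ‖s.v + z‖ = ‖s.v‖ := by
    have h2 : ‖s.v + z‖ ^ 2 = ‖s.v‖ ^ 2 := by
      rw [hsz, norm_sq_add_smul_orth hd1 had, ha, hτ, Real.sq_sqrt hκ0, hκ]; ring
    exact (pow_left_inj₀ (norm_nonneg _) (norm_nonneg _) two_ne_zero).1 h2
  have hzx : ⟪z, x₀⟫_ℂ = -((η : ℝ) : ℂ) := by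
    rw [hz, inner_add_left, inner_neg_left, inner_smul_left, Complex.conj_ofReal, hxx, mul_one, inner_smul_left,
      hdx, mul_zero, add_zero]
  have hxz : ⟪x₀, z⟫_ℂ = -((η : ℝ) : ℂ) := by
    rw [← inner_conj_symm, hzx, map_neg, Complex.conj_ofReal]
  obtain ⟨s', hs'v, hs'E⟩ := exists_state_add hx₀ s z hηE hnorm hzx
  refine ⟨s', by rw [hs'E, hη]; ring, ?_, ?_⟩
  · rw [hs'v, add_sub_cancel_left, hz, inner_add_right, inner_neg_right, inner_smul_right, inner_smul_right, hc,
      hcd, mul_zero, mul_zero, neg_zero, add_zero]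
  · rw [hs'v, add_sub_cancel_left, hxz, map_neg, RCLike.re_to_complex, Complex.ofReal_re, hη]

/-- STEP inside the epoch of a pivot with small `(εθ)_P` (side-condition vector = the moved vector `x₀ − v_P`):
from any state `s` in `P`'s epoch invariant, the radius-preserving step `z = −β(εθ)_s x₀ + k w_P + τ d`,
`w_P = v_P − ⟨x₀, v_P⟩x₀`, `k = −β(εθ)_s(1 − Re⟨v_P, x₀⟩)/‖w_P‖²`, `d ⊥ x₀, v_P, v_s`, reaches a state with
`(εθ) = (1 − β)(εθ)_s`, `⟨x₀ − v_P, z⟩ = 0` and drift `−β(εθ)_s`. [cite: Enflo2023, v2 p.19–20, (45)–(46)] -/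
theorem exists_step_pivot (hH : ¬ FiniteDimensional ℂ H) {x₀ : H} (hx₀ : ‖x₀‖ = 1) {β : ℝ} (hβ0 : 0 ≤ β)
    (hβ1 : β ≤ 1) (P s : State (0 : H →L[ℂ] H) x₀ Vy.S) (hP : P.etheta < 1 / 100)
    (hs : InvP 1 P (x₀ - P.v) s) :
    ∃ s' : State (0 : H →L[ℂ] H) x₀ Vy.S, s'.etheta = (1 - β) * s.etheta ∧
      ⟪x₀ - P.v, s'.v - s.v⟫_ℂ = 0 ∧ re ⟪x₀, s'.v - s.v⟫_ℂ = -(β * s.etheta) := by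
  obtain ⟨hEle, horth, hdrift⟩ := hs
  have hE0 : 0 ≤ s.etheta := s.etheta_nonneg hx₀ Vy.norm_S_le
  have hEP0 : 0 ≤ P.etheta := P.etheta_nonneg hx₀ Vy.norm_S_le
  -- the real coordinates
  obtain ⟨E, hE⟩ : ∃ E : ℝ, E = s.etheta := ⟨_, rfl⟩
  obtain ⟨EP, hEP⟩ : ∃ EP : ℝ, EP = P.etheta := ⟨_, rfl⟩
  obtain ⟨ρs, hρs⟩ : ∃ ρs : ℝ, ρs = ‖s.v‖ ^ 2 := ⟨_, rfl⟩
  obtain ⟨ρP, hρP⟩ : ∃ ρP : ℝ, ρP = ‖P.v‖ ^ 2 := ⟨_, rfl⟩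
  rw [← hE] at hEle hE0 hdrift ⊢
  rw [← hEP] at hEle hEP0 hP hdrift
  have hws := s.window hx₀
  have hwP := P.window hx₀
  have hρs1 : 0.09 ≤ ρs := by rw [hρs]; nlinarith [hws.1]
  have hρP1 : 0.09 ≤ ρP := by rw [hρP]; nlinarith [hwP.1]
  have hρP2 : ρP ≤ 0.49 := by rw [hρP]; nlinarith [hwP.2, norm_nonneg P.v]
  obtain ⟨μs, hμs⟩ : ∃ μs : ℝ, μs = ρs + E := ⟨_, rfl⟩
  obtain ⟨μP, hμP⟩ : ∃ μP : ℝ, μP = ρP + EP := ⟨_, rfl⟩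
  have hvxs : ⟪s.v, x₀⟫_ℂ = (μs : ℂ) := by rw [hμs, hρs, hE]; exact s.inner_v_x₀ hx₀
  have hxvs : ⟪x₀, s.v⟫_ℂ = (μs : ℂ) := by rw [← inner_conj_symm, hvxs, Complex.conj_ofReal]
  have hvxP : ⟪P.v, x₀⟫_ℂ = (μP : ℂ) := by rw [hμP, hρP, hEP]; exact P.inner_v_x₀ hx₀
  have hxvP : ⟪x₀, P.v⟫_ℂ = (μP : ℂ) := by rw [← inner_conj_symm, hvxP, Complex.conj_ofReal]
  have hxx : ⟪x₀, x₀⟫_ℂ = 1 := by rw [inner_self_eq_norm_sq_to_K, hx₀]; simp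
  have hPP : ⟪P.v, P.v⟫_ℂ = (ρP : ℂ) := by rw [hρP, inner_self_eq_norm_sq_to_K]; norm_cast
  -- the epoch invariant in coordinates
  have hPs : ⟪P.v, s.v⟫_ℂ = ((ρP + μs - μP : ℝ) : ℂ) := by
    have h := horth
    rw [inner_sub_left, inner_sub_right, inner_sub_right, hxvs, hxvP, hPP] at h
    have h2 : ⟪P.v, s.v⟫_ℂ = (μs : ℂ) - (μP : ℂ) + (ρP : ℂ) := by linear_combination -h
    rw [h2]; push_cast; ring
  have hsP : ⟪s.v, P.v⟫_ℂ = ((ρP + μs - μP : ℝ) : ℂ) := by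
    rw [← inner_conj_symm, hPs, Complex.conj_ofReal]
  have hdr : |μs - μP| ≤ EP - E := by
    have h := hdrift
    rwa [inner_sub_right, map_sub, hxvs, hxvP, RCLike.re_to_complex, RCLike.re_to_complex, Complex.ofReal_re,
      Complex.ofReal_re, one_mul] at h
  -- the compensating direction w_P
  set wP : H := P.v - (μP : ℂ) • x₀ with hwP_def
  have hxw : ⟪x₀, wP⟫_ℂ = 0 := by
    rw [hwP_def, inner_sub_right, inner_smul_right, hxvP, hxx, mul_one, sub_self]
  have hwx : ⟪wP, x₀⟫_ℂ = 0 := inner_eq_zero_symm.1 hxw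
  obtain ⟨W, hW⟩ : ∃ W : ℝ, W = ρP - μP ^ 2 := ⟨_, rfl⟩
  have hPw : ⟪P.v, wP⟫_ℂ = (W : ℂ) := by
    rw [hwP_def, inner_sub_right, inner_smul_right, hvxP, hPP, hW]; push_cast; ring
  have hw2 : ‖wP‖ ^ 2 = W := by
    rw [hwP_def, norm_sub_sq (𝕜 := ℂ), inner_smul_right, hvxP, RCLike.re_to_complex, ← Complex.ofReal_mul,
      Complex.ofReal_re, norm_sq_real_smul, hx₀, ← hρP, hW]; ring
  have hW07 : (7 : ℝ) / 100 ≤ W := by rw [hW, hμP]; exact arith_W hρP1 hρP2 hEP0 hP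
  have hWpos : 0 < W := by linarith
  obtain ⟨Bw, hBw⟩ : ∃ Bw : ℝ, Bw = ρP + μs - μP - μP * μs := ⟨_, rfl⟩
  have hsw : ⟪s.v, wP⟫_ℂ = (Bw : ℂ) := by
    rw [hwP_def, inner_sub_right, inner_smul_right, hsP, hvxs, hBw]; push_cast; ring
  have hμP1 : μP ≤ 0.5 := by rw [hμP]; linarith
  have hμP0 : 0.09 ≤ μP := by rw [hμP]; linarith
  have hBw0 : 0 ≤ Bw := by
    have h1 : Bw = W + (1 - μP) * (μs - μP) := by rw [hBw, hW]; ring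
    rw [h1]; exact arith_Bw hW07 hμP0 hμP1 (hdr.trans (by linarith))
  -- the step
  obtain ⟨η, hη⟩ : ∃ η : ℝ, η = β * E := ⟨_, rfl⟩
  have hη0 : 0 ≤ η := by rw [hη]; exact mul_nonneg hβ0 hE0
  have hηE : η ≤ E := by rw [hη]; nlinarith
  have hη1 : η ≤ 1 / 100 := by linarith
  obtain ⟨k, hk⟩ : ∃ k : ℝ, k = -(η * (1 - μP)) / W := ⟨_, rfl⟩
  have hkW : k * W = -(η * (1 - μP)) := by rw [hk]; field_simp
  obtain ⟨d, hd1, hxd, hPd, hsd⟩ := exists_unit_orth3 hH x₀ P.v s.v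
  have hdx : ⟪d, x₀⟫_ℂ = 0 := inner_eq_zero_symm.1 hxd
  have hwd : ⟪wP, d⟫_ℂ = 0 := by
    rw [hwP_def, inner_sub_left, inner_smul_left, hPd, hxd, mul_zero, sub_zero]
  set a : H := s.v - (η : ℂ) • x₀ + (k : ℂ) • wP with ha_def
  have ha : ‖a‖ ^ 2 = ρs - 2 * (η * μs) + η ^ 2 + 2 * (k * Bw) + k ^ 2 * W := by
    rw [ha_def, norm_add_sq (𝕜 := ℂ), norm_sub_sq (𝕜 := ℂ), inner_smul_right, hvxs, inner_smul_right,
      inner_sub_left, inner_smul_left, hsw, hxw, mul_zero, sub_zero]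
    simp only [RCLike.re_to_complex, ← Complex.ofReal_mul, Complex.ofReal_re]
    rw [norm_sq_real_smul, norm_sq_real_smul, hx₀, hw2, ← hρs]; ring
  obtain ⟨gap, hgap⟩ : ∃ gap : ℝ, gap = ρs - ‖a‖ ^ 2 := ⟨_, rfl⟩
  have hgapW : gap * W = (2 * η * μs - η ^ 2) * W - 2 * (k * W) * Bw - (k * W) ^ 2 := by
    rw [hgap, ha]; ring
  rw [hkW] at hgapW
  have hμs0 : 0.09 ≤ μs := by rw [hμs]; linarith
  have hgap0 : 0 ≤ gap := by
    have h1 : 0 ≤ gap * W := by rw [hgapW]; exact arith_gap hμs0 hμP0 hμP1 hW07 hBw0 hη0 hη1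
    exact (mul_nonneg_iff_of_pos_right hWpos).1 h1
  set τ := Real.sqrt gap with hτ
  set z : H := -((η : ℂ) • x₀) + (k : ℂ) • wP + (τ : ℂ) • d with hz
  have hsz : s.v + z = a + (τ : ℂ) • d := by rw [hz, ha_def, sub_eq_add_neg]; abel
  have had : ⟪a, d⟫_ℂ = 0 := by
    rw [ha_def, inner_add_left, inner_sub_left, inner_smul_left, inner_smul_left, hsd, hxd, hwd, mul_zero,
      mul_zero, sub_zero, add_zero]
  have hnorm : ‖s.v + z‖ = ‖s.v‖ := by
    have h2 : ‖s.v + z‖ ^ 2 = ‖s.v‖ ^ 2 := by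
      rw [hsz, norm_sq_add_smul_orth hd1 had, hτ, Real.sq_sqrt hgap0, hgap, hρs]; ring
    exact (pow_left_inj₀ (norm_nonneg _) (norm_nonneg _) two_ne_zero).1 h2
  have hzx : ⟪z, x₀⟫_ℂ = -((η : ℝ) : ℂ) := by
    rw [hz, inner_add_left, inner_add_left, inner_neg_left, inner_smul_left, Complex.conj_ofReal, hxx, mul_one,
      inner_smul_left, hwx, mul_zero, add_zero, inner_smul_left, hdx, mul_zero, add_zero]
  have hxz : ⟪x₀, z⟫_ℂ = -((η : ℝ) : ℂ) := by
    rw [← inner_conj_symm, hzx, map_neg, Complex.conj_ofReal]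
  obtain ⟨s', hs'v, hs'E⟩ := exists_state_add hx₀ s z (hE ▸ hηE) hnorm hzx
  refine ⟨s', by rw [hs'E, ← hE, hη]; ring, ?_, ?_⟩
  · rw [hs'v, add_sub_cancel_left, hz]
    have h3 : (k : ℂ) * (W : ℂ) = -((η : ℂ) * (1 - (μP : ℂ))) := by exact_mod_cast hkW
    simp only [inner_add_right, inner_neg_right, inner_smul_right, inner_sub_left, hxx, hvxP, hxw, hPw, hxd,
      hPd]
    linear_combination (-1 : ℂ) * h3
  · rw [hs'v, add_sub_cancel_left, hxz, map_neg, RCLike.re_to_complex, Complex.ofReal_re, hη]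

end ZeroModel

/-- **(C) Consistency of the residual claim.**  On an infinite-dimensional Hilbert space the zero operator
satisfies `MCStep.Claim 0 x₀ Vy.S 1 β (fun E ↦ 200|E|)` for every unit `x₀` and `β ∈ [0, 1]`: side-condition
vector `x₀ − v_P` (angle `0`) at pivots with `(εθ)_P < 1/100`, a unit vector orthogonal to `x₀, v_P` (angle
`≤ 2 ≤ 200(εθ)_P`) otherwise; steps radius-preserving with drift exactly `−β(εθ)_s` (`ZeroModel.exists_step_pivot`,
`ZeroModel.exists_step_orth`).  So the hypothesis of `MCStep.hasNontrivialClosedInvariantSubspace_of_claim` is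
satisfiable (by an operator WITH invariant subspaces — consistency only), with the drift constant `C = 1` that (B)
shows to be the least possible. [cite: Enflo2023, v2 p.17–20, (40), (45), (46)] -/
theorem claim_zero (hH : ¬ FiniteDimensional ℂ H) (x₀ : H) (hx₀ : ‖x₀‖ = 1) {β : ℝ} (hβ0 : 0 ≤ β)
    (hβ1 : β ≤ 1) : Claim (0 : H →L[ℂ] H) x₀ Vy.S 1 β (fun E => 200 * |E|) := by
  intro P
  have hG0 : ∀ x : ℝ, 0 ≤ (fun E : ℝ => 200 * |E|) x := fun x => by show (0:ℝ) ≤ 200 * |x|; positivity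
  by_cases hP : P.etheta < 1 / 100
  · refine ⟨x₀ - P.v, (pivot_clause_trivial hx₀ _ hG0 P).1, (pivot_clause_trivial hx₀ _ hG0 P).2,
      fun s hs => ?_⟩
    obtain ⟨s', hE, hside, hdrift⟩ := ZeroModel.exists_step_pivot hH hx₀ hβ0 hβ1 P s hP hs
    refine ⟨s', le_of_eq hE, hside, ?_⟩
    rw [hdrift, abs_neg, abs_of_nonneg (mul_nonneg hβ0 (s.etheta_nonneg hx₀ Vy.norm_S_le)), one_mul]
  · rw [not_lt] at hP
    obtain ⟨c, hc1, hxc, -, -⟩ := ZeroModel.exists_unit_orth3 hH x₀ P.v P.v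
    have hc0 : c ≠ 0 := by
      intro h; rw [h, norm_zero] at hc1; exact zero_ne_one hc1
    refine ⟨c, hc0, ?_, fun s _ => ?_⟩
    · have hEP : 0 ≤ P.etheta := P.etheta_nonneg hx₀ Vy.norm_S_le
      calc ‖((‖x₀ - P.v‖ : ℝ) : ℂ) • c - ((‖c‖ : ℝ) : ℂ) • (x₀ - P.v)‖
          ≤ ‖((‖x₀ - P.v‖ : ℝ) : ℂ) • c‖ + ‖((‖c‖ : ℝ) : ℂ) • (x₀ - P.v)‖ := norm_sub_le _ _
        _ = 2 * (‖c‖ * ‖x₀ - P.v‖) := by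
          rw [norm_smul, norm_smul, Complex.norm_real, Complex.norm_real, Real.norm_of_nonneg (norm_nonneg _),
            Real.norm_of_nonneg (norm_nonneg _)]; ring
        _ ≤ (fun E : ℝ => 200 * |E|) P.etheta * (‖c‖ * ‖x₀ - P.v‖) := by
          apply mul_le_mul_of_nonneg_right _ (by positivity)
          show (2 : ℝ) ≤ 200 * |P.etheta|
          rw [abs_of_nonneg hEP]; linarith
    · obtain ⟨s', hE, hside, hdrift⟩ :=
        ZeroModel.exists_step_orth hH hx₀ hβ0 hβ1 c (inner_eq_zero_symm.1 hxc) s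
      refine ⟨s', le_of_eq hE, hside, ?_⟩
      rw [hdrift, abs_neg, abs_of_nonneg (mul_nonneg hβ0 (s.etheta_nonneg hx₀ Vy.norm_S_le)), one_mul]

/-- (B) and (C) together: under the hard window, `C = 1` is exactly the threshold — the Claim is refutable for every
operator when `C < 1` and satisfiable (by `T = 0`) when `C = 1`. [cite: Enflo2023, v2 (45), p.19] -/
theorem claim_threshold (hH : ¬ FiniteDimensional ℂ H) (x₀ : H) (hx₀ : ‖x₀‖ = 1) {β : ℝ} (hβ0 : 0 < β)
    (hβ1 : β ≤ 1) :
    (∀ C < 1, ¬ Claim (0 : H →L[ℂ] H) x₀ Vy.S C β (fun E => 200 * |E|)) ∧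
      Claim (0 : H →L[ℂ] H) x₀ Vy.S 1 β (fun E => 200 * |E|) :=
  ⟨fun C hC => not_claim_of_C_lt_one (0 : H →L[ℂ] H) (by rw [norm_zero]; norm_num) x₀ hx₀ hC hβ0 _,
    claim_zero hH x₀ hx₀ hβ0.le hβ1⟩

end MCStep

end Literature.Analysis.OperatorTheory.Enflo2023

end
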